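import Literature.MathematicalPhysics.QuantumFieldTheory.Balaban1983to89.B9Eq335CoveragePAtLettersY

/-!
# `Balaban1983to89.B9Eq336RegularAtAllBondsP` — T. Bałaban, *Propagators for lattice gauge theories in a background field*, Commun. Math. Phys. **99** (1985)
# 389–434 [Balaban1985BackgroundPropagators] p. 396 (3.35)–(3.36) with p. 422 («From the regularity condition (3.36) … we have the estimate
# |(H\*J)(b)| ≦ O(1)Mα₀(Lʲη)⁻³ for b ∈ Λ_j»): AT PRINT'S CUBE CLASS (node00-def-Y's MODULE 2-P `B9BackgroundsKLevelV1P.cubeClassP`, «O(1) ≧ 10», per-cube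
# constant) THE CLASS (3.35)–(3.36) YIELDS r06's BOND-LOCAL DATUM `B9Eq336CurrentBound.RegularAt` AT **EVERY** BOND OF THE TORUS (scale `L^{lev x}η` of the
# bond's own territory, constant `10·L⁴·(M·α₀)`), HENCE THE CURRENT BOUND `|J_μ(x)| ≦ 10⁴(d+1)·C·(L^{lev x}η)⁻³` AT EVERY BOND — the covering step that
# `B9Eq336CurrentBound` (SCOPE (ii)) and `B9Ineq3131Regular` ∕ `B9Ineq3137Regular` (their hypothesis `hreg`) leave displayed, DISCHARGED

statement-level skeleton of published theorems with citation tags; proofs where landed; nothing here is a claim about the Yang–Mills mass gap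

THE PRINT (verbatim).  p. 396: *«At first let us introduce a class of cubes. For each cube □ of this class there exists a unique index j, 0 ≦ j ≦ k, such that
□ ⊂ Bʲ(Λ_j) ∪ B^{j+1}(Λ_{j+1}), □ ∩ Bʲ(Λ_j) ≠ ∅, and □ is a union of several big blocks of the lattice T_{L^{−j}}, which implies that its size in the lattice T_η is
O(1)MLʲη. Here O(1) will mean a number ≧ 10. … for an arbitrary cube □ of the described above class, and for a configuration U there exists a gauge transformation
u on □ such that U^u = e^{iηA}. and if the index of □ is j, then |A| < O(1)Mα₀(Lʲη)⁻¹, |∇^ηA| < O(1)Mα₀(Lʲη)⁻² on □, where O(1)M is a size of □ in T_{L^{−j}}; (3.35)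
|∂^{η\*}∂^ηA| < O(1)Mα₀(Lʲη)⁻³ on □. (3.36)»*  p. 422 (after (3.136)): *«From the regularity condition (3.36) and the inequality (3.133) we have the estimate
|(H\*J)(b)| ≦ O(1)Mα₀(Lʲη)⁻³ for b ∈ Λ_j.»*  The print USES (3.36) only through the pointwise smallness of the current `J = D\*η⁻² Im ∂U` of (3.11) on the
territory of index `j` (r06's `B9Eq336CurrentBound`, module docstring).

WHY THIS FILE (cell context).  r06's `B9Eq336CurrentBound` proves `|J_μ(x)| ≦ (1 + 10⁴(d−1)C)·C·ξ⁻³` from the bond-local datum `RegularAt T U η C ξ μ x` (a gauge, a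
field and a site set `N ⊇` the STENCIL `{x, x+e_κ, x−e_ν, x−e_ν+e_μ}` of the bond carrying (3.35)–(3.36) at scale `ξ`), and records as SCOPE (ii): *«the covering
statement (which cube of the class of p. 396 carries a given bond and its stencil, and the overlap of cubes of different indices) is the geometry of (3.16)/p. 396,
not typed here»*; its consumers `B9Ineq3131Regular` ∕ `B9Ineq3137Regular` and this seat's lineage (`B9Eq3136HstarJBound`, `Thm/…N06HstarJAtPins[W]Phys`,
`Thm/…N06HTransposeAtPinsPhys`, binder `hreg`) all DISPLAY `∀ μ x, RegularAt …` as a hypothesis.  node00-def-Y g22's RULING-W′ (pub-ymgap INBOX 2026-08-28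
11:58Z): the class of record becomes PRINT's class `bg9YP` (CASCADE-R STEP 3); at the small-cube variant `bg9Y ∕ bg9K` (MODULE 2, sizes `n ≤ 10`) the covering
FAILS on one-block level slabs (dag-n06-j `B9Eq335CoverageAtLettersY.reg335_flipNegOne_of_uncovered`).  THIS FILE proves the covering AT PRINT'S CLASS.

THE GEOMETRY (★ `exists_cubeClassP_stencil`; dag-n06-j's `exists_cubeClassP_plaquette` with the corner moved back ONE big block).  For a site `x` of level `j`, let
`c₀` be the corner of its big `j`-block (`exists_block_corner`) and `c₁ := c₀ − S·𝟙`, `S = bigSide j` — still on the big-`j`-block grid (`S ∣ N₀`).  The aligned cube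
`Q := torusCube c₁ (10·S)` contains `x`, every `x ± e_κ`, every `x − e_ν + e_μ` and every `x + e_ν + e_κ` (they lie in `torusCube c₁ (2S+2)`).  By the collar axiom
(2.2) (`B9Eq335CoverageWindow.levV1_window`, `10L ≤ 2L² ≤ R`) all levels on `Q` lie in `{j−1, j, j+1}`; if no site of level `j−1` occurs, `(Q, j, 10)` is a P-triple;
otherwise no site of level `j+1` occurs either ((2.2) at level `j`, `R ≥ 10`) and `Q` is `10L` big `(j−1)`-blocks per side meeting level `j−1`: `(Q, j−1, 10L)` is a
P-triple.  Either way the threshold `c ≤ 10` is met.  In the first case the per-cube datum of (3.36) has scale `Lʲη` and constant `10·Mα₀`; in the second scale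
`L^{j−1}η = (Lʲη)∕L` and constant `10L·Mα₀`, converted to scale `Lʲη` at the cost `L³` on the third bound (`L`, `L²` on the first two): ONE constant
`10·L⁴·(M·α₀)` serves every bond at the scale of ITS OWN territory.

WHAT IS PROVED (sorry-free; 0 `def`; nothing of [B9] asserted — lattice geometry + bookkeeping over r06's (3.36) theorem).
* §1 torus-cube bookkeeping on a `Params` torus: `exists_backCorner` (the corner `c − S·𝟙` stays on the grid when `S ∣ N₀`), `mem_torusCube_backCorner`
  (`torusCube c s ⊆ torusCube (c−S𝟙) (s+S)`), `unshift_mem_torusCube_backCorner` (`x − e_ν` likewise, `S ≥ 1`), shift commutation.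
* §2 ★ **`exists_cubeClassP_stencil`** (`c ≤ 10`: for every site `x` and direction `μ` a triple `q ∈ cubeClassP i c` containing `x`, all `x+e_κ`, all `x−e_κ`, all
  `x−e_ν+e_μ`, all `x+e_ν+e_κ`, with `(q.2.1, q.2.2) = (lev x, 10)` or `(lev x − 1, 10L)`).
* §3 `regularAt_mono` (r06's `RegularAt` is monotone in the three displayed bound VALUES `Cξ⁻¹`, `ηCξ⁻²`, `Cξ⁻³`) and the two constant conversions
  `bounds_sameScale` ∕ `bounds_scaleUp` used below.
* §4 ★★★ **`regularAt_of_reg336P`**: `c ≤ 10 → 0 ≤ α₀ → (bg9KP 𝔸 G i).Reg336 c α₀ U → ∀ μ x, RegularAt (shiftsV1 _) U η (10·L⁴·(M·α₀)) (L^{lev x}η) μ x`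
  (`η = (kGeo i).eta`, `L = (kGeo i).L`, `M = (kGeo i).M`); ★★ **`norm_J_le_of_reg336P`**: with `C := 10·L⁴·(M·α₀) ≤ 1`, at EVERY bond
  `‖J_μ(x)‖ ≤ 10⁴·(d+1)·C·((L^{lev x}η)³)⁻¹` (r06's `norm_J_le_blocks` BY NAME, block map = the level of the site) — LITERALLY the `hJ` ∕ `h336` ∕ `hreg`-output
  shape of the consumers with `blk := id`, `len x := L^{lev x}η`.
* §5 member forms at def-Y's `bg9YP` (both pins carry the class; the first pin is the member's own torus): ★★ **`regularAt_of_regYP336`**, **`norm_J_le_of_regYP336`**.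
* §6 THE SCALE OF A PINNED BLOCK MAP: ★ `lvl_window_of_distT_le_one` (a `d_T ≤ 1` pin — the N06 certificate's `hβ1 : d_T(β(bI f), blkV1 f) ≤ 1` — forces
  `|j(bI f) − lev(f.src)| ≤ 1`, by (2.2) in walk form `levelGapT`, `RM ≥ 2`), `regularAt_window` (`(C, ξ) ↦ (L³C, ξ′)` for `ξ′ ≤ Lξ`), ★★★
  **`regularAt_pinScale_of_reg336P`** ∕ **`regularAt_pinScale_of_regYP336`**: at the scale `L^{j(σ f)}η = len (σ f)` of ANY `d_T ≤ 1`-faithful block map `σ`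
  (the certificate's `bI x`), constant `10·L⁷·(M·α₀)` — the SHAPE of this lineage's binder `hreg` (`Thm/…N06HstarJAtPins[W]Phys`, `Thm/…N06HTransposeAtPinsPhys`:
  `RegularAt (shiftsV1 …) U (etaBY x.toKIdx) (c_J·(M_xα₀)) ((geo9Y x).len (bI x ⟨s, 0⟩)) μ s`, `c_J := 10L⁷`) from the STEP-3 premise `(bg9YP …).Reg336 c35Y α₀ U`.
MODEL ∕ DECLARED READINGS.  def-Y's carriers, classes and level function BY NAME (MODULES 2, 2-P, 3); n06-j's window and corner lemmas BY NAME; r06's `RegularAt`,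
`regularAt_of_reg336Cube`, `norm_J_le_blocks` BY NAME.  The constant `10L⁴` is a witness (print: «O(1)»; `L`-dependent because a bond on a thin level-`j` feature is
covered at index `j − 1`, exactly as in n06-j's `B9Eq335ClassBridgePV1`); constants are fixed in print's order `L, M, α₀` («α₀ so small that O(1)Mα₀ is still
sufficiently small», p. 409).  The scale attached to a bond is that of its SOURCE site's territory `B^{lev x}(Λ_{lev x})`; a consumer with another block map converts
with `regularAt_mono`.
HONEST SCOPE.  Lattice geometry + bookkeeping; the covering step of p. 396∕p. 422 made explicit at print's class; NOT a node discharge, NOT summit progress;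
count-neutral; nothing continuum ∕ OS ∕ mass gap ∕ Clay.  Cell `pub-ymgap` (HUMAN RULING D-0062), Track A node N06 [B9], seat `pub-ymgap-dag-n06-w8` (g3; the
`(H\*J)`-road lineage F5–F11, binder `hreg`), 2026-08-28.  NEW file importing `B9Eq335CoveragePAtLettersY` only; nothing landed is modified.  Net new unproved facts: 0.
-/

noncomputable section

namespace Literature.MathematicalPhysics.QuantumFieldTheory.Balaban1983to89.B9Eq336RegularAtAllBondsP

open Literature.MathematicalPhysics.QuantumFieldTheory.Balaban1983to89
open B6KLevelCensusIndexV1 B9BackgroundsKLevelV1 B6GlobalChartV1 Node00 B9BackgroundsKLevelV1P B9Eq335CoverageWindow B9Eq335CoveragePAtLettersY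
open Literature.MathematicalPhysics.QuantumFieldTheory.Balaban1983to89.B6MultiLevelBoxOperator (bigSide)
open Literature.MathematicalPhysics.QuantumFieldTheory.Balaban1983to89.B9Eq335RegularityClasses (Reg336Cube regularAt_of_reg336Cube scaleLen_pos)
open Literature.MathematicalPhysics.QuantumFieldTheory.Balaban1983to89.B9Eq336CurrentBound (RegularAt norm_J_le_blocks)
open Literature.MathematicalPhysics.QuantumFieldTheory.Balaban1983to89.LatticeNorms (scaleLen scaleLen_succ)
open Literature.MathematicalPhysics.QuantumFieldTheory.Balaban1983to89.B9PinMembersKLevelV1 (MemberY bg9Y)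

/-! ## §1 Torus-cube bookkeeping: the corner moved back one block -/

section TorusCube

variable {P : Params}

/-- ★ THE BACK-SHIFTED CORNER: if `S` divides the period `N₀` and every coordinate of the corner `c` is a multiple of `S`, then the corner `c − S·𝟙` (one block back
in every direction) again has every coordinate a multiple of `S`. [cite: Balaban1985BackgroundPropagators, p.396 («a union of several big blocks»), bookkeeping] -/
theorem exists_backCorner (c : Site P 0) {S : ℕ} (hSN : S ∣ P.sitesPerDir 0) (hc : ∀ μ, S ∣ (c μ).val) :
    ∃ c' : Site P 0, (∀ μ, S ∣ (c' μ).val) ∧ ∀ μ, c' μ = c μ - (S : ZMod (P.sitesPerDir 0)) := by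
  set N := P.sitesPerDir 0 with hNdef
  have hSN' : S ≤ N := Nat.le_of_dvd (Nat.pos_of_ne_zero (P.sitesPerDir_ne_zero 0)) hSN
  refine ⟨fun μ => ((((c μ).val + (N - S) : ℕ)) : ZMod N), fun μ => ?_, fun μ => ?_⟩
  · have hNS : S ∣ N - S := by
      obtain ⟨q, hq⟩ := hSN
      exact ⟨q - 1, by rw [hq, Nat.mul_sub_one]⟩
    rw [ZMod.val_natCast]
    exact (Nat.dvd_mod_iff hSN).2 (Nat.dvd_add (hc μ) hNS)
  · have h1 : (((N - S : ℕ)) : ZMod N) = -(S : ZMod N) := by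
      rw [Nat.cast_sub hSN', ZMod.natCast_self, zero_sub]
    push_cast
    rw [ZMod.natCast_zmod_val, h1, sub_eq_add_neg]

/-- `torusCube c s ⊆ torusCube (c − S·𝟙) (s + S)`. [cite: Balaban1985BackgroundPropagators, p.396, bookkeeping] -/
theorem mem_torusCube_backCorner {c c' : Site P 0} {S : ℕ} (hc' : ∀ μ, c' μ = c μ - (S : ZMod (P.sitesPerDir 0))) {s : ℕ} {x : Site P 0}
    (hx : x ∈ torusCube c s) : x ∈ torusCube c' (s + S) := by
  intro μ
  have h1 : x μ - c' μ = (x μ - c μ) + (S : ZMod (P.sitesPerDir 0)) := by rw [hc' μ]; ring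
  rw [h1]
  calc ((x μ - c μ) + (S : ZMod (P.sitesPerDir 0))).val ≤ (x μ - c μ).val + (S : ZMod (P.sitesPerDir 0)).val := ZMod.val_add_le _ _
    _ ≤ (x μ - c μ).val + S := by rw [ZMod.val_natCast]; exact Nat.add_le_add_left (Nat.mod_le _ _) _
    _ < s + S := Nat.add_lt_add_right (hx μ) _

/-- `x ∈ torusCube c s ⟹ x − e_ν ∈ torusCube (c − S·𝟙) (s + S)` (`S ≥ 1`). [cite: Balaban1985BackgroundPropagators, p.396, bookkeeping] -/
theorem unshift_mem_torusCube_backCorner {c c' : Site P 0} {S : ℕ} (hS : 1 ≤ S) (hc' : ∀ μ, c' μ = c μ - (S : ZMod (P.sitesPerDir 0))) {s : ℕ}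
    {x : Site P 0} (hx : x ∈ torusCube c s) (ν : Fin P.d) : x.unshift ν ∈ torusCube c' (s + S) := by
  intro μ
  by_cases hμ : μ = ν
  · subst hμ
    have h0 : (x.unshift μ) μ = x μ - 1 := by simp only [Site.unshift, Function.update_self]
    have h1 : (x.unshift μ) μ - c' μ = (x μ - c μ) + ((S - 1 : ℕ) : ZMod (P.sitesPerDir 0)) := by
      rw [h0, hc' μ, Nat.cast_sub hS, Nat.cast_one]; ring
    rw [h1]
    calc ((x μ - c μ) + ((S - 1 : ℕ) : ZMod (P.sitesPerDir 0))).val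
        ≤ (x μ - c μ).val + ((S - 1 : ℕ) : ZMod (P.sitesPerDir 0)).val := ZMod.val_add_le _ _
      _ ≤ (x μ - c μ).val + (S - 1) := by rw [ZMod.val_natCast]; exact Nat.add_le_add_left (Nat.mod_le _ _) _
      _ < s + S := by have := hx μ; omega
  · have h0 : (x.unshift ν) μ = x μ := by simp only [Site.unshift, Function.update_of_ne hμ]
    have h := mem_torusCube_backCorner hc' hx μ
    rwa [h0]

/-- `(x + e_μ)_μ = x_μ + 1`. [folklore] -/
private theorem shift_apply_self' (x : Site P 0) (μ : Fin P.d) : x.shift μ μ = x μ + 1 := by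
  simp only [Site.shift, Function.update_self]

/-- `(x + e_μ)_ν = x_ν` for `ν ≠ μ`. [folklore] -/
private theorem shift_apply_ne' (x : Site P 0) {μ ν : Fin P.d} (h : ν ≠ μ) : x.shift μ ν = x ν := by
  simp only [Site.shift, Function.update_of_ne h]

/-- lattice translations commute. [folklore] -/
private theorem shift_shift_comm (x : Site P 0) (μ ν : Fin P.d) : (x.shift μ).shift ν = (x.shift ν).shift μ := by
  funext κ
  by_cases h1 : κ = ν
  · subst h1
    by_cases h2 : κ = μ
    · subst h2; rfl
    · rw [shift_apply_self', shift_apply_ne' _ h2, shift_apply_ne' _ h2, shift_apply_self']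
  · by_cases h2 : κ = μ
    · subst h2
      rw [shift_apply_ne' _ h1, shift_apply_self', shift_apply_self', shift_apply_ne' _ h1]
    · rw [shift_apply_ne' _ h1, shift_apply_ne' _ h2, shift_apply_ne' _ h2, shift_apply_ne' _ h1]

/-- NODE 00's torus shifts commute (the hypothesis `hT` of r06's current bounds). [cite: Balaban1985BackgroundPropagators, p.389 (T_η a torus), bookkeeping] -/
theorem shiftsV1_comm' (μ ν : Fin P.d) (x : Site P 0) : shiftsV1 P μ (shiftsV1 P ν x) = shiftsV1 P ν (shiftsV1 P μ x) :=
  shift_shift_comm x ν μ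

end TorusCube

/-! ## §2 Every bond stencil is covered by print's cube class -/

section Coverage

variable {d ℓ : ℕ} {hd : 1 ≤ d + 1} {hL : Odd (ℓ + 1) ∧ 1 < ℓ + 1} {b₀ b₁ : ℝ}
variable (i : KIdx d ℓ hd hL b₀ b₁)

/-- ★ **EVERY BOND STENCIL IS COVERED BY PRINT'S CUBE CLASS** (def-Y's `cubeClassP`, threshold `c ≤ 10`): for every site `x` and direction `μ` there is a class triple
`(Q, j′, n)` whose cube contains `x`, every `x + e_κ`, every `x − e_κ`, every `x − e_ν + e_μ` (the stencil of r06's `RegularAt` at the bond `⟨x, x+e_μ⟩`) and every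
`x + e_ν + e_κ` (the plaquette corners), with `(j′, n) = (lev x, 10)` or `(lev x − 1, 10L)` — the aligned cube of `10` big `(lev x)`-blocks cornered ONE BLOCK BELOW
`x`'s block, and the (2.2) window argument of `exists_cubeClassP_plaquette`. [cite: Balaban1985BackgroundPropagators, p.396 (the class, «≧ 10»), p.422; Balaban1984PropagatorsII, (2.2) p.224] -/
theorem exists_cubeClassP_stencil {c : ℝ} (hc : c ≤ 10) (x : Site (PV d ℓ i.m i.K hd hL) 0) (μ : Fin (PV d ℓ i.m i.K hd hL).d) :
    ∃ q ∈ cubeClassP i c,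
      (x ∈ q.1 ∧ (∀ κ, x.shift κ ∈ q.1) ∧ (∀ κ, x.unshift κ ∈ q.1) ∧ (∀ ν, (x.unshift ν).shift μ ∈ q.1) ∧ (∀ ν κ, (x.shift ν).shift κ ∈ q.1)) ∧
      ((q.2.1 = levV1 i x ∧ q.2.2 = 10) ∨ (q.2.1 + 1 = levV1 i x ∧ q.2.2 = 10 * (ℓ + 1))) := by
  classical
  set j := levV1 i x with hjdef
  set S := bigSide ℓ i.Mh j with hSdef
  have hj1 : 1 ≤ j := levV1_pos i x
  have hjk : j ≤ i.k := levV1_le i x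
  have h8 : 8 ≤ i.Mh := i.hM8
  have hℓ : 4 ≤ ℓ := i.hℓ
  have hR : 2 * (ℓ + 1) ^ 2 ≤ i.R := i.hR2
  have hS1 : 1 ≤ S := by
    rw [hSdef]; unfold B6MultiLevelBoxOperator.bigSide
    calc 1 ≤ 8 * 1 := by norm_num
      _ ≤ i.Mh * (ℓ + 1) ^ (j + 1) := Nat.mul_le_mul h8 (Nat.one_le_pow _ _ (Nat.succ_pos ℓ))
  -- the period is a multiple of `S`
  have hN : (PV d ℓ i.m i.K hd hL).sitesPerDir 0 = bigSide ℓ i.Mh i.k * i.P' 0 := by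
    rw [← i.hN 0, B6MultiLevelTorusOperator.N0_eq_bigSide_mul]
  have hsk : S ∣ bigSide ℓ i.Mh i.k := ⟨(ℓ + 1) ^ (i.k - j), by rw [hSdef]; exact bigSide_eq_mul_pow hjk⟩
  have hsN : S ∣ (PV d ℓ i.m i.K hd hL).sitesPerDir 0 := by rw [hN]; exact dvd_mul_of_dvd_left hsk _
  obtain ⟨c₀, hc₀, hx₀⟩ := exists_block_corner i x j hjk
  obtain ⟨c₁, hc₁, hc₁'⟩ := exists_backCorner c₀ hsN hc₀
  -- the stencil inside the 10-cube cornered at `c₁`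
  have h10R : 10 * (ℓ + 1) ≤ i.R := le_trans (by nlinarith) hR
  have hx2 : x ∈ torusCube c₁ (S + S) := mem_torusCube_backCorner hc₁' hx₀
  have hsub2 : torusCube c₁ (S + S) ⊆ torusCube c₁ (10 * S) := torusCube_mono c₁ (by omega)
  have hsub3 : torusCube c₁ (S + S + 1) ⊆ torusCube c₁ (10 * S) := torusCube_mono c₁ (by omega)
  have hsub4 : torusCube c₁ (S + S + 1 + 1) ⊆ torusCube c₁ (10 * S) := torusCube_mono c₁ (by omega)
  have hxQ : x ∈ torusCube c₁ (10 * S) := hsub2 hx2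
  have hst : x ∈ torusCube c₁ (10 * S) ∧ (∀ κ, x.shift κ ∈ torusCube c₁ (10 * S)) ∧ (∀ κ, x.unshift κ ∈ torusCube c₁ (10 * S)) ∧
      (∀ ν, (x.unshift ν).shift μ ∈ torusCube c₁ (10 * S)) ∧ (∀ ν κ, (x.shift ν).shift κ ∈ torusCube c₁ (10 * S)) :=
    ⟨hxQ, fun κ => hsub3 (shift_mem_torusCube_succ hx2 κ), fun κ => hsub2 (unshift_mem_torusCube_backCorner hS1 hc₁' hx₀ κ),
      fun ν => hsub3 (shift_mem_torusCube_succ (unshift_mem_torusCube_backCorner hS1 hc₁' hx₀ ν) μ),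
      fun ν κ => hsub4 (shift_mem_torusCube_succ (shift_mem_torusCube_succ hx2 ν) κ)⟩
  have hwin : ∀ y ∈ torusCube c₁ (10 * S), j ≤ levV1 i y + 1 ∧ levV1 i y ≤ j + 1 := fun y hy => levV1_window i h10R hxQ hy
  by_cases hlow : ∃ y ∈ torusCube c₁ (10 * S), levV1 i y + 1 = j
  · -- CASE B: a site of level `j − 1` occurs ⇒ no site of level `j + 1` (sepT at level `j`), index `j − 1`, size `10L`
    obtain ⟨y, hy, hylev⟩ := hlow
    have hy1 : 1 ≤ levV1 i y := levV1_pos i y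
    have hnoup : ∀ z ∈ torusCube c₁ (10 * S), levV1 i z ≤ j := by
      intro z hz
      by_contra hzl
      push Not at hzl
      have hyl : i.D.lev (toBox i.hN y).1 = levV1 i y := rfl
      have hzl' : i.D.lev (toBox i.hN z).1 = levV1 i z := rfl
      have hsep := i.D.sepT j (toBox i.hN y).1 (toBox i.hN y).2 (toBox i.hN z).1 (toBox i.hN z).2
        (by rw [hyl]; omega) (by rw [hzl']; omega)
      have hd' := torusSupNorm_lt_of_mem_torusCube i hy hz
      have hlt : i.R * S < 10 * S := by exact_mod_cast lt_trans hsep hd'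
      have : 10 ≤ i.R := le_trans (by nlinarith) h10R
      nlinarith
    have hS' : S = (ℓ + 1) * bigSide ℓ i.Mh (j - 1) := by
      rw [hSdef]; unfold B6MultiLevelBoxOperator.bigSide
      rw [show j + 1 = (j - 1 + 1) + 1 by omega, pow_succ]; ring
    have hcube : torusCube c₁ (10 * S) = torusCube c₁ ((10 * (ℓ + 1)) * bigSide ℓ i.Mh (j - 1)) := by
      rw [hS']; ring_nf
    refine ⟨(torusCube c₁ (10 * S), j - 1, 10 * (ℓ + 1)), ?_, hst, Or.inr ⟨by simp only; omega, rfl⟩⟩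
    rw [hcube]
    refine alignedCube_mem_cubeClassP i (j := j - 1) (n := 10 * (ℓ + 1)) (by omega) (by omega) (by omega) ?_ c₁ ?_ ?_ ?_
    · calc c ≤ 10 := hc
        _ ≤ ((10 * (ℓ + 1) : ℕ) : ℝ) := by exact_mod_cast (by omega : 10 ≤ 10 * (ℓ + 1))
    · intro κ
      exact dvd_trans (Dvd.intro_left _ hS'.symm) (hc₁ κ)
    · intro z hz
      rw [← hcube] at hz
      have h1 := hwin z hz
      have h2 := hnoup z hz
      omega
    · exact ⟨y, by rw [← hcube]; exact hy, by omega⟩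
  · -- CASE A: no site of level `j − 1` ⇒ levels in `{j, j+1}`, index `j`, size `10`
    push Not at hlow
    refine ⟨(torusCube c₁ (10 * S), j, 10), ?_, hst, Or.inl ⟨rfl, rfl⟩⟩
    refine alignedCube_mem_cubeClassP i hj1 hjk (by norm_num) (by exact_mod_cast hc) c₁ hc₁ ?_ ⟨x, hxQ, rfl⟩
    intro z hz
    have h1 := hwin z hz
    have h2 := hlow z hz
    omega

end Coverage

/-! ## §3 r06's bond-local datum is monotone in the displayed bound values -/

section Mono

variable {𝔸 : Type*} [NormedRing 𝔸] [NormedAlgebra ℂ 𝔸] [CompleteSpace 𝔸] {S : Type*} {ι : Type*} [Fintype ι] [LinearOrder ι]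
variable {T : ι → Equiv.Perm S} {U : ι → S → 𝔸ˣ}

/-- `RegularAt` is MONOTONE in the three displayed bound values: the same gauge, field and site set witness the datum with any larger bounds `C′ξ′⁻¹ ≥ Cξ⁻¹`,
`ηC′ξ′⁻² ≥ ηCξ⁻²`, `C′ξ′⁻³ ≥ Cξ⁻³`. [cite: Balaban1985BackgroundPropagators, (3.35)–(3.36) p.396, bookkeeping] -/
theorem regularAt_mono {η C ξ C' ξ' : ℝ} {μ : ι} {x : S} (h1 : C * ξ⁻¹ ≤ C' * ξ'⁻¹) (h2 : η * (C * (ξ ^ 2)⁻¹) ≤ η * (C' * (ξ' ^ 2)⁻¹))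
    (h3 : C * (ξ ^ 3)⁻¹ ≤ C' * (ξ' ^ 3)⁻¹) (h : RegularAt T U η C ξ μ x) : RegularAt T U η C' ξ' μ x := by
  obtain ⟨u, A, N, hx, hN₁, hN₂, hN₃, hu, hu', hg, hA, hD, h36⟩ := h
  exact ⟨u, A, N, hx, hN₁, hN₂, hN₃, hu, hu', hg, fun κ z hz => (hA κ z hz).trans h1, fun κ ν z hz => (hD κ ν z hz).trans h2, h36.trans h3⟩

/-- same scale, larger constant: `(n·m, ξ) ↦ (n·L⁴·m, ξ)` for `L ≥ 1`, `m ≥ 0` (the index-`j` case). [cite: Balaban1985BackgroundPropagators, p.396, bookkeeping] -/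
theorem bounds_sameScale {n L m ξ η : ℝ} (hn : 0 ≤ n) (hL : 1 ≤ L) (hm : 0 ≤ m) (hξ : 0 < ξ) (hη : 0 ≤ η) :
    n * m * ξ⁻¹ ≤ n * L ^ 4 * m * ξ⁻¹ ∧ η * (n * m * (ξ ^ 2)⁻¹) ≤ η * (n * L ^ 4 * m * (ξ ^ 2)⁻¹) ∧
      n * m * (ξ ^ 3)⁻¹ ≤ n * L ^ 4 * m * (ξ ^ 3)⁻¹ := by
  have hL4 : 1 ≤ L ^ 4 := one_le_pow₀ hL
  have hnm : n * m ≤ n * L ^ 4 * m := by nlinarith [mul_nonneg hn hm]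
  refine ⟨mul_le_mul_of_nonneg_right hnm (inv_nonneg.2 hξ.le), mul_le_mul_of_nonneg_left ?_ hη,
    mul_le_mul_of_nonneg_right hnm (inv_nonneg.2 (pow_pos hξ 3).le)⟩
  exact mul_le_mul_of_nonneg_right hnm (inv_nonneg.2 (pow_pos hξ 2).le)

/-- one scale up: `(n·L·m, ξ₀) ↦ (n·L⁴·m, L·ξ₀)` for `L ≥ 1`, `m ≥ 0`, `ξ₀ > 0` (the index-`(j−1)` case: `L`, `L²`, `L³` on the three bounds).
[cite: Balaban1985BackgroundPropagators, p.396, bookkeeping] -/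
theorem bounds_scaleUp {n L m ξ₀ η : ℝ} (hn : 0 ≤ n) (hL : 1 ≤ L) (hm : 0 ≤ m) (hξ₀ : 0 < ξ₀) (hη : 0 ≤ η) :
    n * L * m * ξ₀⁻¹ ≤ n * L ^ 4 * m * (L * ξ₀)⁻¹ ∧ η * (n * L * m * (ξ₀ ^ 2)⁻¹) ≤ η * (n * L ^ 4 * m * ((L * ξ₀) ^ 2)⁻¹) ∧
      n * L * m * (ξ₀ ^ 3)⁻¹ ≤ n * L ^ 4 * m * ((L * ξ₀) ^ 3)⁻¹ := by
  have hL0 : 0 < L := lt_of_lt_of_le one_pos hL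
  have hL1 : L ≠ 0 := hL0.ne'
  have hξ1 : ξ₀ ≠ 0 := hξ₀.ne'
  have e1 : n * L ^ 4 * m * (L * ξ₀)⁻¹ = n * L ^ 3 * m * ξ₀⁻¹ := by field_simp
  have e2 : n * L ^ 4 * m * ((L * ξ₀) ^ 2)⁻¹ = n * L ^ 2 * m * (ξ₀ ^ 2)⁻¹ := by field_simp
  have e3 : n * L ^ 4 * m * ((L * ξ₀) ^ 3)⁻¹ = n * L * m * (ξ₀ ^ 3)⁻¹ := by field_simp
  rw [e1, e2, e3]
  have hL2 : L ≤ L ^ 2 := by nlinarith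
  have hL3 : L ≤ L ^ 3 := by nlinarith
  have hnm3 : n * L * m ≤ n * L ^ 3 * m := by nlinarith [mul_nonneg hn hm]
  have hnm2 : n * L * m ≤ n * L ^ 2 * m := by nlinarith [mul_nonneg hn hm]
  exact ⟨mul_le_mul_of_nonneg_right hnm3 (inv_nonneg.2 hξ₀.le),
    mul_le_mul_of_nonneg_left (mul_le_mul_of_nonneg_right hnm2 (inv_nonneg.2 (pow_pos hξ₀ 2).le)) hη, le_rfl⟩

end Mono

/-! ## §4 (3.35)–(3.36) at print's class ⟹ `RegularAt` at every bond ⟹ the current bound at every bond -/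

section Main

variable {d ℓ : ℕ} {hd : 1 ≤ d + 1} {hL : Odd (ℓ + 1) ∧ 1 < ℓ + 1} {b₀ b₁ : ℝ}
variable {𝔸 : Type} [NormedRing 𝔸] [NormedAlgebra ℂ 𝔸] [CompleteSpace 𝔸] {G : Subgroup 𝔸ˣ}
variable (i : KIdx d ℓ hd hL b₀ b₁)

/-- ★★★ **(3.35)–(3.36) AT PRINT'S CLASS ⟹ r06's BOND-LOCAL DATUM AT EVERY BOND**: for `c ≤ 10`, `α₀ ≥ 0` and a configuration `U` in the class (3.36) of the member
over print's cube class (`(bg9KP 𝔸 G i).Reg336 c α₀ U`), EVERY bond `⟨x, x + e_μ⟩` of the torus carries `RegularAt (shiftsV1 _) U η C ξ μ x` with `ξ = L^{lev x}η` (the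
scale of the territory `B^{lev x}(Λ_{lev x}) ∋ x`) and `C = 10·L⁴·(M·α₀)` — the covering cube of `exists_cubeClassP_stencil`, the per-cube datum `reg336P_iff`,
r06's `regularAt_of_reg336Cube`, and the constant conversions of §3. [cite: Balaban1985BackgroundPropagators, (3.35)–(3.36) p.396, p.422 («From the regularity condition (3.36) … for b ∈ Λ_j»); Balaban1984PropagatorsII, (2.2) p.224] -/
theorem regularAt_of_reg336P {c α₀ : ℝ} (hc : c ≤ 10) (hα : 0 ≤ α₀) {U : CfgV1 (PV d ℓ i.m i.K hd hL) 𝔸} (h : (bg9KP 𝔸 G i).Reg336 c α₀ U)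
    (μ : Fin (PV d ℓ i.m i.K hd hL).d) (x : Site (PV d ℓ i.m i.K hd hL) 0) :
    RegularAt (shiftsV1 (PV d ℓ i.m i.K hd hL)) U (kGeo i).eta (10 * (kGeo i).L ^ 4 * ((kGeo i).M * α₀))
      (scaleLen (kGeo i).L (kGeo i).eta (levV1 i x)) μ x := by
  obtain ⟨hη, hL1, hM⟩ := eta_pos_L_one_le_M_pos i
  have hm : 0 ≤ (kGeo i).M * α₀ := mul_nonneg hM.le hα
  obtain ⟨q, hq, ⟨hx, h₁, h₂, h₃, -⟩, hidx⟩ := exists_cubeClassP_stencil i hc x μ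
  have hcube := ((reg336P_iff i c α₀ U).1 h).2 q hq
  have hreg : RegularAt (shiftsV1 (PV d ℓ i.m i.K hd hL)) U (kGeo i).eta ((q.2.2 : ℝ) * ((kGeo i).M * α₀))
      (scaleLen (kGeo i).L (kGeo i).eta q.2.1) μ x :=
    regularAt_of_reg336Cube (shiftsV1 (PV d ℓ i.m i.K hd hL)) U hη hcube hx (fun κ => h₁ κ) (fun ν => h₂ ν) (fun ν => h₃ ν)
  rcases hidx with ⟨hj, hn⟩ | ⟨hj, hn⟩
  · -- index `lev x`, size `10`: same scale, constant `10·Mα₀ ≤ 10·L⁴·Mα₀`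
    rw [hj, hn] at hreg
    have hξ := scaleLen_pos hL1 hη (levV1 i x)
    obtain ⟨b1, b2, b3⟩ := bounds_sameScale (n := (10 : ℝ)) (by norm_num) hL1 hm hξ hη.le
    exact regularAt_mono (by exact_mod_cast b1) (by exact_mod_cast b2) (by exact_mod_cast b3) (by exact_mod_cast hreg)
  · -- index `lev x − 1`, size `10L`: scale `L^{lev x − 1}η`, `L^{lev x}η = L·L^{lev x − 1}η`, constant `10L·Mα₀ ↦ 10L⁴·Mα₀`
    rw [hn] at hreg
    have hξ₀ := scaleLen_pos hL1 hη q.2.1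
    have hsc : scaleLen (kGeo i).L (kGeo i).eta (levV1 i x) = (kGeo i).L * scaleLen (kGeo i).L (kGeo i).eta q.2.1 := by
      rw [← hj, scaleLen_succ]
    have hLℓ : (kGeo i).L = ((ℓ + 1 : ℕ) : ℝ) := rfl
    obtain ⟨b1, b2, b3⟩ := bounds_scaleUp (n := (10 : ℝ)) (by norm_num) hL1 hm hξ₀ hη.le
    have hcast : (((10 * (ℓ + 1) : ℕ)) : ℝ) * ((kGeo i).M * α₀) = 10 * (kGeo i).L * ((kGeo i).M * α₀) := by rw [hLℓ]; push_cast; ring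
    rw [hcast] at hreg
    rw [hsc]
    exact regularAt_mono (by simpa [mul_assoc] using b1) (by simpa [mul_assoc] using b2) (by simpa [mul_assoc] using b3) hreg

/-- ★★ **THE CURRENT BOUND AT EVERY BOND FROM PRINT'S CLASS (3.36)** — print p. 422's «From the regularity condition (3.36) … we have the estimate … ≦ O(1)Mα₀(Lʲη)⁻³
for b ∈ Λ_j» for the CURRENT `J = D\*η⁻² Im ∂U` of (3.11) at every bond of the torus, at the scale of the bond's own territory: with `C := 10·L⁴·(M·α₀) ≤ 1`,
`‖J_μ(x)‖ ≤ 10⁴·(d+1)·C·((L^{lev x}η)³)⁻¹` (r06's `norm_J_le_blocks` with block map = the level of the source site). [cite: Balaban1985BackgroundPropagators, (3.36) p.396, (3.11) p.392, p.422; Balaban1984PropagatorsII, (2.2) p.224] -/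
theorem norm_J_le_of_reg336P {c α₀ : ℝ} (hc : c ≤ 10) (hα : 0 ≤ α₀) {U : CfgV1 (PV d ℓ i.m i.K hd hL) 𝔸} (h : (bg9KP 𝔸 G i).Reg336 c α₀ U)
    (hC1 : 10 * (kGeo i).L ^ 4 * ((kGeo i).M * α₀) ≤ 1) (μ : Fin (PV d ℓ i.m i.K hd hL).d) (x : Site (PV d ℓ i.m i.K hd hL) 0) :
    ‖B9Eq39Adjoint.J (shiftsV1 (PV d ℓ i.m i.K hd hL)) U (kGeo i).eta μ x‖ ≤
      10 ^ 4 * ((d : ℝ) + 1) * (10 * (kGeo i).L ^ 4 * ((kGeo i).M * α₀)) * (scaleLen (kGeo i).L (kGeo i).eta (levV1 i x) ^ 3)⁻¹ := by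
  obtain ⟨hη, hL1, hM⟩ := eta_pos_L_one_le_M_pos i
  have hC0 : 0 ≤ 10 * (kGeo i).L ^ 4 * ((kGeo i).M * α₀) := by have := mul_nonneg hM.le hα; positivity
  have hlen : ∀ y : Site (PV d ℓ i.m i.K hd hL) 0, (kGeo i).eta ≤ scaleLen (kGeo i).L (kGeo i).eta (levV1 i y) := fun y =>
    le_mul_of_one_le_left hη.le (one_le_pow₀ hL1)
  have hJ := norm_J_le_blocks (shiftsV1 (PV d ℓ i.m i.K hd hL)) (shiftsV1_comm' (P := PV d ℓ i.m i.K hd hL)) hη hC0 hC1 U (fun y => y)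
    (fun y => scaleLen (kGeo i).L (kGeo i).eta (levV1 i y)) hlen (fun ν y => regularAt_of_reg336P i hc hα h ν y) μ x
  simpa [Fintype.card_fin] using hJ

end Main

/-! ## §5 Member forms at def-Y's `bg9YP` (the class of record after CASCADE-R STEP 3; first pin = the member's own torus) -/

section Member

variable {d ℓ : ℕ} {hd : 1 ≤ d + 1} {hL : Odd (ℓ + 1) ∧ 1 < ℓ + 1} {b₀ b₁ : ℝ} {Mstar : ℕ}
variable {𝔸 : Type} [NormedRing 𝔸] [NormedAlgebra ℂ 𝔸] [CompleteSpace 𝔸] {G : Subgroup 𝔸ˣ}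
variable (x : MemberY d ℓ hd hL b₀ b₁ Mstar)

/-- ★★ **MEMBER FORM**: a configuration in the class (3.36) of the member over print's class (`(bg9YP 𝔸 G x).Reg336 c α₀ U`, `c ≤ 10`) is regular in r06's sense at
EVERY bond of the member's torus, scale `L^{lev s}η` (`η = (kGeo x.toKIdx).eta`, def-Y's `etaBY x.toKIdx` by `rfl`), constant `10·L⁴·(M·α₀)` (`M = (geo9Y x).M`). [cite: Balaban1985BackgroundPropagators, (3.35)–(3.36) p.396, p.422] -/
theorem regularAt_of_regYP336 {c α₀ : ℝ} (hc : c ≤ 10) (hα : 0 ≤ α₀) {U : CfgV1 (PV d ℓ x.m x.K hd hL) 𝔸} (h : (bg9YP 𝔸 G x).Reg336 c α₀ U)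
    (μ : Fin (PV d ℓ x.m x.K hd hL).d) (s : Site (PV d ℓ x.m x.K hd hL) 0) :
    RegularAt (shiftsV1 (PV d ℓ x.m x.K hd hL)) U (kGeo x.toKIdx).eta (10 * (kGeo x.toKIdx).L ^ 4 * ((B9PinMembersKLevelV1.geo9Y x).M * α₀))
      (scaleLen (kGeo x.toKIdx).L (kGeo x.toKIdx).eta (levV1 x.toKIdx s)) μ s :=
  regularAt_of_reg336P x.toKIdx hc hα ((reg336YP_iff x c α₀ U).1 h).1 μ s

/-- ★★ **MEMBER FORM OF THE CURRENT BOUND**: `‖J(U)_μ(s)‖ ≤ 10⁴(d+1)·C·((L^{lev s}η)³)⁻¹` at every bond of the member's torus, `C = 10·L⁴·(M·α₀) ≤ 1` (def-Y's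
`JY x.toKIdx U ⟨s, μ⟩` is this `J` by `Node00.JY_apply`). [cite: Balaban1985BackgroundPropagators, (3.36) p.396, (3.11) p.392, p.422] -/
theorem norm_J_le_of_regYP336 {c α₀ : ℝ} (hc : c ≤ 10) (hα : 0 ≤ α₀) {U : CfgV1 (PV d ℓ x.m x.K hd hL) 𝔸} (h : (bg9YP 𝔸 G x).Reg336 c α₀ U)
    (hC1 : 10 * (kGeo x.toKIdx).L ^ 4 * ((B9PinMembersKLevelV1.geo9Y x).M * α₀) ≤ 1)
    (μ : Fin (PV d ℓ x.m x.K hd hL).d) (s : Site (PV d ℓ x.m x.K hd hL) 0) :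
    ‖B9Eq39Adjoint.J (shiftsV1 (PV d ℓ x.m x.K hd hL)) U (kGeo x.toKIdx).eta μ s‖ ≤
      10 ^ 4 * ((d : ℝ) + 1) * (10 * (kGeo x.toKIdx).L ^ 4 * ((B9PinMembersKLevelV1.geo9Y x).M * α₀)) *
        (scaleLen (kGeo x.toKIdx).L (kGeo x.toKIdx).eta (levV1 x.toKIdx s) ^ 3)⁻¹ :=
  norm_J_le_of_reg336P x.toKIdx hc hα ((reg336YP_iff x c α₀ U).1 h).1 hC1 μ s

end Member

/-! ## §6 The scale of a PINNED block map: the level window of a `d_T ≤ 1` pin, and `RegularAt` at the pin's scale -/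

section PinWindow

open Literature.MathematicalPhysics.QuantumFieldTheory.Balaban1983to89.B6Ineq2142KLevelV1 (β lvl beta_level)
open Literature.MathematicalPhysics.QuantumFieldTheory.Balaban1983to89.B6Geom246MultiLevelTorus (geomT bondT levelGapT connectedT)
open Literature.MathematicalPhysics.QuantumFieldTheory.Balaban1983to89.B6SectAOperatorsV1 (BondIdx)

variable {d ℓ : ℕ} {hd : 1 ≤ d + 1} {hL : Odd (ℓ + 1) ∧ 1 < ℓ + 1} {b₀ b₁ : ℝ}
variable {𝔸 : Type} [NormedRing 𝔸] [NormedAlgebra ℂ 𝔸] [CompleteSpace 𝔸] {G : Subgroup 𝔸ˣ}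
variable (i : KIdx d ℓ hd hL b₀ b₁)

/-- ★ **THE LEVEL WINDOW OF A `d_T ≤ 1` PIN**: if the carrier block `β b ∈ 𝔅` of an index bond `b` and the block of a fine bond `f` are at torus graph distance
`d_T ≤ 1` (the faithfulness pin `hβ1` of the N06 certificate's block maps `bI x`), then their levels differ by at most one: `lev(f.src) ≤ j(b) + 1` and
`j(b) ≤ lev(f.src) + 1` — a single admissible bond never joins blocks two levels apart ((2.2) in walk form, `levelGapT`, `RM ≥ 2`).
[cite: Balaban1984PropagatorsII, (2.2) p.224, (2.45)–(2.46) p.231] -/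
theorem lvl_window_of_distT_le_one (b : BondIdx (domT i.hN i.D i.hk)) (f : PBond (PV d ℓ i.m i.K hd hL) 0)
    (h : (geomT i.D).dist (β i.hN i.D i.hk b) (blkV1 i.hN i.D f) ≤ 1) :
    levV1 i f.src ≤ lvl i.hN i.D i.hk b + 1 ∧ lvl i.hN i.D i.hk b ≤ levV1 i f.src + 1 := by
  set y := β i.hN i.D i.hk b with hydef
  set y' := blkV1 i.hN i.D f with hy'def
  have hk1 : 1 ≤ i.k := le_trans one_le_two i.hk2
  have hyl : y.1.1 = lvl i.hN i.D i.hk b := beta_level i.hN i.D i.hk hk1 b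
  have hy'l : y'.1.1 = levV1 i f.src := rfl
  have hdist : (((bondT i.D).dist y y' : ℕ) : ℝ) ≤ 1 := h
  have hd1 : (bondT i.D).dist y y' ≤ 1 := by exact_mod_cast hdist
  have h8 : 8 ≤ i.Mh := i.hM8
  have hconn : (bondT i.D).Connected := connectedT (D := i.D) (by omega) (fun μ => by have := i.hP5 μ; omega)
  obtain ⟨p, hp⟩ := (hconn.preconnected y y').exists_walk_length_eq_dist
  have hgap : ∀ ⦃j : ℕ⦄ ⦃u v : ↥(B6Geom246MultiLevelBox.bset i.D.toDomains)⦄, u.1.1 < j → j < v.1.1 →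
      ∀ q : (bondT i.D).Walk u v, i.R * ((ℓ + 1) * i.Mh) - 1 + 1 ≤ q.length := levelGapT i.D
  have hR : 2 * (ℓ + 1) ^ 2 ≤ i.R := i.hR2
  have hR2 : 2 ≤ i.R := le_trans (Nat.le_mul_of_pos_right 2 (pow_pos (Nat.succ_pos ℓ) 2)) hR
  have hM1 : 0 < (ℓ + 1) * i.Mh := Nat.mul_pos (Nat.succ_pos ℓ) (by omega)
  have hRM : 2 ≤ i.R * ((ℓ + 1) * i.Mh) := le_trans hR2 (Nat.le_mul_of_pos_right _ hM1)
  rw [← hyl, ← hy'l]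
  constructor
  · by_contra hlt
    push Not at hlt
    have hq := hgap (j := y.1.1 + 1) (u := y) (v := y') (by omega) (by omega) p
    omega
  · by_contra hlt
    push Not at hlt
    have hq := hgap (j := y'.1.1 + 1) (u := y') (v := y) (by omega) (by omega) p.reverse
    rw [SimpleGraph.Walk.length_reverse] at hq
    omega

/-- one level of slack on the scale: `ξ′ ≤ L·ξ ⟹ ξ⁻ᵖ ≤ L³·ξ′⁻ᵖ` for `p ≤ 3`. [cite: Balaban1985BackgroundPropagators, p.396, bookkeeping] -/
theorem inv_pow_le_of_window {L ξ ξ' : ℝ} (hL : 1 ≤ L) (hξ : 0 < ξ) (hξ' : 0 < ξ') (hw : ξ' ≤ L * ξ) {p : ℕ} (hp : p ≤ 3) :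
    (ξ ^ p)⁻¹ ≤ L ^ 3 * (ξ' ^ p)⁻¹ := by
  have h1 : ξ' ^ p ≤ L ^ 3 * ξ ^ p :=
    calc ξ' ^ p ≤ (L * ξ) ^ p := pow_le_pow_left₀ hξ'.le hw p
      _ = L ^ p * ξ ^ p := mul_pow L ξ p
      _ ≤ L ^ 3 * ξ ^ p := mul_le_mul_of_nonneg_right (pow_le_pow_right₀ hL hp) (pow_pos hξ p).le
  rw [← div_eq_mul_inv, le_div_iff₀ (pow_pos hξ' p), inv_mul_le_iff₀ (pow_pos hξ p)]
  linarith [mul_comm (ξ ^ p) (L ^ 3)]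

/-- `RegularAt` survives moving the scale up by at most one level at the cost `L³` on the constant: `(C, ξ) ↦ (L³·C, ξ′)` whenever `ξ′ ≤ L·ξ`.
[cite: Balaban1985BackgroundPropagators, (3.35)–(3.36) p.396, bookkeeping] -/
theorem regularAt_window {S : Type*} {ι : Type*} [Fintype ι] [LinearOrder ι] {T : ι → Equiv.Perm S} {U : ι → S → 𝔸ˣ}
    {η C ξ ξ' L : ℝ} {μ : ι} {x : S} (hη : 0 ≤ η) (hC : 0 ≤ C) (hL : 1 ≤ L) (hξ : 0 < ξ) (hξ' : 0 < ξ') (hw : ξ' ≤ L * ξ)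
    (h : RegularAt T U η C ξ μ x) : RegularAt T U η (L ^ 3 * C) ξ' μ x := by
  have h1 := inv_pow_le_of_window hL hξ hξ' hw (p := 1) (by norm_num)
  have h2 := inv_pow_le_of_window hL hξ hξ' hw (p := 2) (by norm_num)
  have h3 := inv_pow_le_of_window hL hξ hξ' hw (p := 3) le_rfl
  rw [pow_one, pow_one] at h1
  refine regularAt_mono ?_ ?_ ?_ h
  · calc C * ξ⁻¹ ≤ C * (L ^ 3 * ξ'⁻¹) := mul_le_mul_of_nonneg_left h1 hC
      _ = L ^ 3 * C * ξ'⁻¹ := by ring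
  · refine mul_le_mul_of_nonneg_left ?_ hη
    calc C * (ξ ^ 2)⁻¹ ≤ C * (L ^ 3 * (ξ' ^ 2)⁻¹) := mul_le_mul_of_nonneg_left h2 hC
      _ = L ^ 3 * C * (ξ' ^ 2)⁻¹ := by ring
  · calc C * (ξ ^ 3)⁻¹ ≤ C * (L ^ 3 * (ξ' ^ 3)⁻¹) := mul_le_mul_of_nonneg_left h3 hC
      _ = L ^ 3 * C * (ξ' ^ 3)⁻¹ := by ring

/-- ★★★ **`RegularAt` AT THE SCALE OF A PINNED BLOCK MAP**: for a configuration in the class (3.36) over print's cube class and a block map `σ` from the fine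
bonds to the index bonds that is faithful within `d_T ≤ 1` (the certificate's pin `hβ1`), every bond `⟨f.src, f.src + e_μ⟩` is regular in r06's sense at the
scale `L^{j(σ f)}η = (kGeo i).len (σ f)` of the INDEX BOND'S block, with the constant `10·L⁷·(M·α₀)` (three more powers of `L` for the one-level window).
[cite: Balaban1985BackgroundPropagators, (3.35)–(3.36) p.396, p.422; Balaban1984PropagatorsII, (2.2) p.224, (2.45) p.231] -/
theorem regularAt_pinScale_of_reg336P {c α₀ : ℝ} (hc : c ≤ 10) (hα : 0 ≤ α₀) {U : CfgV1 (PV d ℓ i.m i.K hd hL) 𝔸}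
    (h : (bg9KP 𝔸 G i).Reg336 c α₀ U) (σ : PBond (PV d ℓ i.m i.K hd hL) 0 → BondIdx (domT i.hN i.D i.hk))
    (hσ : ∀ f, (geomT i.D).dist (β i.hN i.D i.hk (σ f)) (blkV1 i.hN i.D f) ≤ 1)
    (μ : Fin (PV d ℓ i.m i.K hd hL).d) (f : PBond (PV d ℓ i.m i.K hd hL) 0) :
    RegularAt (shiftsV1 (PV d ℓ i.m i.K hd hL)) U (kGeo i).eta (10 * (kGeo i).L ^ 7 * ((kGeo i).M * α₀)) ((kGeo i).len (σ f)) μ f.src := by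
  obtain ⟨hη, hL1, hM⟩ := eta_pos_L_one_le_M_pos i
  have hm : 0 ≤ (kGeo i).M * α₀ := mul_nonneg hM.le hα
  have hreg := regularAt_of_reg336P i hc hα h μ f.src
  obtain ⟨-, hw⟩ := lvl_window_of_distT_le_one i (σ f) f (hσ f)
  have hlen : (kGeo i).len (σ f) = scaleLen (kGeo i).L (kGeo i).eta (lvl i.hN i.D i.hk (σ f)) := rfl
  have hξ := scaleLen_pos hL1 hη (levV1 i f.src)
  have hξ' := scaleLen_pos hL1 hη (lvl i.hN i.D i.hk (σ f))
  have hwin : scaleLen (kGeo i).L (kGeo i).eta (lvl i.hN i.D i.hk (σ f)) ≤ (kGeo i).L * scaleLen (kGeo i).L (kGeo i).eta (levV1 i f.src) := by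
    rw [← scaleLen_succ]
    exact B9Eq335RegularityClasses.scaleLen_mono hL1 hη.le hw
  have hC : 0 ≤ 10 * (kGeo i).L ^ 4 * ((kGeo i).M * α₀) := by positivity
  have h' := regularAt_window hη.le hC hL1 hξ hξ' hwin hreg
  have e : (kGeo i).L ^ 3 * (10 * (kGeo i).L ^ 4 * ((kGeo i).M * α₀)) = 10 * (kGeo i).L ^ 7 * ((kGeo i).M * α₀) := by ring
  rw [hlen, ← e]
  exact h'

variable {Mstar : ℕ}

/-- ★★★ **MEMBER FORM AT THE CERTIFICATE'S PINS** (the supplier of this lineage's binder `hreg` at the STEP-3 premise): for `x : MemberY`, a block map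
`bI : FBondY x.toKIdx → IBondY x.toKIdx` with the faithfulness pin `hβ1` (VERBATIM the certificate's), and `U` in the class (3.36) of the member over print's cube class
(`(bg9YP 𝔸 G x).Reg336 c α₀ U`, `c ≤ 10`; e.g. `c35Y = 10`), EVERY bond `⟨s, s + e_μ⟩` of the member's torus carries
`RegularAt (shiftsV1 _) U η (10·L⁷·(M·α₀)) ((geo9Y x).len (bI f)) μ s` for every fine bond `f` out of `s` (`η = (kGeo x.toKIdx).eta = etaBY x.toKIdx` and
`M = (geo9Y x).M` by `rfl`). [cite: Balaban1985BackgroundPropagators, (3.35)–(3.36) p.396, p.422; Balaban1984PropagatorsII, (2.2) p.224] -/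
theorem regularAt_pinScale_of_regYP336 (x : MemberY d ℓ hd hL b₀ b₁ Mstar) {c α₀ : ℝ} (hc : c ≤ 10) (hα : 0 ≤ α₀)
    {U : CfgV1 (PV d ℓ x.m x.K hd hL) 𝔸} (h : (bg9YP 𝔸 G x).Reg336 c α₀ U) (bI : FBondY x.toKIdx → IBondY x.toKIdx)
    (hβ1 : ∀ f : FBondY x.toKIdx, (geomT x.D).dist (β x.hN x.D x.hk (bI f)) (blkV1 x.hN x.D f) ≤ 1)
    (μ : Fin (PV d ℓ x.m x.K hd hL).d) (f : FBondY x.toKIdx) :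
    RegularAt (shiftsV1 (PV d ℓ x.m x.K hd hL)) U (kGeo x.toKIdx).eta (10 * (kGeo x.toKIdx).L ^ 7 * ((B9PinMembersKLevelV1.geo9Y x).M * α₀))
      ((B9PinMembersKLevelV1.geo9Y x).len (bI f)) μ f.src :=
  regularAt_pinScale_of_reg336P x.toKIdx hc hα ((reg336YP_iff x c α₀ U).1 h).1 bI hβ1 μ f

end PinWindow

end Literature.MathematicalPhysics.QuantumFieldTheory.Balaban1983to89.B9Eq336RegularAtAllBondsP

end
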